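import Summits.BirchSwinnertonDyer.Rank1Residual.Additive.X3BranchLayerCharTower
import HarnessLib

/-!
# X3, the DEGENERATE rows OFF the sub-locus, T-SIDE OVER HIGHER LAYERS: an ADDITIVE CHARACTER OF THE
# `N`-TH LAYER GROUP that dies deep in the `ℤ_p`-tower is a multiple of the layer character of level `N`
# (cell `bsd-eis`, seat `bsd-eis-x3` gen 8; gen 7's `X3BranchLayerCharTower.lean` (the case `N = 1`)
# with an arbitrary base layer `N` — STEP 2 of the independence argument for the T-side classes over
# the layer `ℚ_N`, x3-MEMO-10 §5 (f); route K1 `AdditiveBranchIMC`, crux `GordTwoRankZeroOffCaseOne` —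
# supports only)

HONEST FRAMING (`run/shared/lean/pub/bsd-eis/README.md` §4): THEOREMS ONLY (no `def`, no named fact,
no `sorry`); nothing is booked; no label, tier or count of record moves.

## What

`κ : ZpExtension K p`, `γ` a topological generator, `L_n = κ.layerSubgroup n`; `ψ : Γ_K → ℤ/p` ADDITIVE
ON `L_N`. Then (`ZpExtension.exists_layerSubgroup_succ_mul_pow`: `L_n = ⋃_j L_{n+1}·(γ^{pⁿ})^j`):
* `addCharOnBase_pow` — `ψ(x^k) = k·ψ(x)` for `x ∈ L_N`;
* `addCharOnBase_eq_zero_of_succ` — for `n ≥ N`, `ψ` vanishing on `L_{n+2}` vanishes on `L_{n+1}`;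
* `addCharOnBase_eq_zero_layer_succ` — if `ψ` vanishes on `L_{m+N+2}` it vanishes on `L_{N+1}`;
* `exists_addCharOnBase_eq_mul` — then on `L_N`: `σ = h·(γ^{p^N})^j` with `h ∈ L_{N+1}` and
  `ψ(σ) = j·ψ(γ^{p^N})`.
References: [Washington1997] §13.1; [SerreLocalFields1979] Ch. X §3.
-/

set_option autoImplicit false

namespace Summit.BirchSwinnertonDyer.Rank1Residual.Additive

namespace LayerCharTower

open Field Literature.NumberTheory.EllipticCurves

variable {K : Type} [Field K] {p : ℕ} [Fact p.Prime] (κ : ZpExtension K p)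

/-- `ψ(1) = 0` for `ψ` additive on `L_N`. [folklore] -/
theorem addCharOnBase_one {N : ℕ} {ψ : absoluteGaloisGroup K → ZMod p}
    (hψ : ∀ a ∈ κ.layerSubgroup N, ∀ b ∈ κ.layerSubgroup N, ψ (a * b) = ψ a + ψ b) : ψ 1 = 0 := by
  have h := hψ 1 (κ.layerSubgroup N).one_mem 1 (κ.layerSubgroup N).one_mem
  rw [mul_one] at h
  have : ψ 1 + ψ 1 = ψ 1 + 0 := by rw [add_zero]; exact h.symm
  exact add_left_cancel this

/-- **`ψ(x^k) = k·ψ(x)`** for `x ∈ L_N` and `ψ` additive on `L_N`. [folklore] -/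
theorem addCharOnBase_pow {N : ℕ} {ψ : absoluteGaloisGroup K → ZMod p}
    (hψ : ∀ a ∈ κ.layerSubgroup N, ∀ b ∈ κ.layerSubgroup N, ψ (a * b) = ψ a + ψ b)
    {x : absoluteGaloisGroup K} (hx : x ∈ κ.layerSubgroup N) (k : ℕ) :
    ψ (x ^ k) = (k : ZMod p) * ψ x := by
  induction k with
  | zero => rw [pow_zero, addCharOnBase_one κ hψ, Nat.cast_zero, zero_mul]
  | succ k ih =>
    rw [pow_succ, hψ _ ((κ.layerSubgroup N).pow_mem hx k) _ hx, ih, Nat.cast_succ]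
    ring

/-- **One step down the tower**: for `n ≥ N`, if `ψ` (additive on `L_N`) vanishes on `L_{n+2}` then
it vanishes on `L_{n+1}`: every `σ ∈ L_{n+1}` is `h·(γ^{p^{n+1}})^j` with `h ∈ L_{n+2}`, and
`ψ((γ^{p^{n+1}})^j) = j·p·ψ(γ^{pⁿ}) = 0` (`γ^{pⁿ} ∈ L_n ≤ L_N`). [cite: Washington1997, §13.1] -/
theorem addCharOnBase_eq_zero_of_succ {N : ℕ} {ψ : absoluteGaloisGroup K → ZMod p}
    (hψ : ∀ a ∈ κ.layerSubgroup N, ∀ b ∈ κ.layerSubgroup N, ψ (a * b) = ψ a + ψ b)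
    {γ : absoluteGaloisGroup K} (hγ : κ.IsTopGenerator γ) {n : ℕ} (hn : N ≤ n)
    (hvan : ∀ σ ∈ κ.layerSubgroup (n + 2), ψ σ = 0) :
    ∀ σ ∈ κ.layerSubgroup (n + 1), ψ σ = 0 := by
  intro σ hσ
  obtain ⟨h, j, hj⟩ := κ.exists_layerSubgroup_succ_mul_pow hγ (n + 1) ⟨σ, hσ⟩
  change σ = (h : absoluteGaloisGroup K) * (γ ^ p ^ (n + 1)) ^ j at hj
  have hγnN : γ ^ p ^ n ∈ κ.layerSubgroup N :=
    κ.layerSubgroup_antitone hn (pow_mem_layerSubgroup κ hγ n)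
  have hγs : γ ^ p ^ (n + 1) = (γ ^ p ^ n) ^ p := by rw [pow_succ, pow_mul]
  have hγsN : γ ^ p ^ (n + 1) ∈ κ.layerSubgroup N := by
    rw [hγs]; exact (κ.layerSubgroup N).pow_mem hγnN p
  have hhN : (h : absoluteGaloisGroup K) ∈ κ.layerSubgroup N :=
    κ.layerSubgroup_antitone (by omega) h.2
  rw [hj, hψ _ hhN _ ((κ.layerSubgroup N).pow_mem hγsN j), hvan _ h.2, zero_add,
    addCharOnBase_pow κ hψ hγsN, hγs, addCharOnBase_pow κ hψ hγnN, ZMod.natCast_self, zero_mul,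
    mul_zero]

/-- **Down to the layer `N + 1`**: if `ψ` (additive on `L_N`) vanishes on `L_{m+N+2}` then it vanishes
on `L_{N+1}`. [cite: Washington1997, §13.1] -/
theorem addCharOnBase_eq_zero_layer_succ {N : ℕ} {ψ : absoluteGaloisGroup K → ZMod p}
    (hψ : ∀ a ∈ κ.layerSubgroup N, ∀ b ∈ κ.layerSubgroup N, ψ (a * b) = ψ a + ψ b)
    {γ : absoluteGaloisGroup K} (hγ : κ.IsTopGenerator γ) (m : ℕ)
    (hvan : ∀ σ ∈ κ.layerSubgroup (m + N + 2), ψ σ = 0) :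
    ∀ σ ∈ κ.layerSubgroup (N + 1), ψ σ = 0 := by
  induction m with
  | zero =>
    rw [zero_add] at hvan
    exact addCharOnBase_eq_zero_of_succ κ hψ hγ (n := N) le_rfl hvan
  | succ m ih =>
    refine ih (addCharOnBase_eq_zero_of_succ κ hψ hγ (n := m + N + 1) (by omega) ?_)
    rw [show m + N + 1 + 2 = m + 1 + N + 2 by ring]
    exact hvan

/-- **An additive character of `L_N` vanishing on `L_{N+1}` is a multiple of the layer character**:
for `σ = h·(γ^{p^N})^j ∈ L_N` (`h ∈ L_{N+1}`), `ψ(σ) = j·ψ(γ^{p^N})`. [cite: Washington1997, §13.1] -/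
theorem addCharOnBase_eq_mul_of_layer_succ {N : ℕ} {ψ : absoluteGaloisGroup K → ZMod p}
    (hψ : ∀ a ∈ κ.layerSubgroup N, ∀ b ∈ κ.layerSubgroup N, ψ (a * b) = ψ a + ψ b)
    {γ : absoluteGaloisGroup K} (hγ : κ.IsTopGenerator γ)
    (hvan : ∀ σ ∈ κ.layerSubgroup (N + 1), ψ σ = 0)
    {σ : absoluteGaloisGroup K} {h : absoluteGaloisGroup K} (hh : h ∈ κ.layerSubgroup (N + 1))
    {j : ℕ} (hσ : σ = h * (γ ^ p ^ N) ^ j) : ψ σ = (j : ZMod p) * ψ (γ ^ p ^ N) := by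
  have hγN : γ ^ p ^ N ∈ κ.layerSubgroup N := pow_mem_layerSubgroup κ hγ N
  rw [hσ, hψ _ (κ.layerSubgroup_antitone (by omega) hh) _ ((κ.layerSubgroup N).pow_mem hγN j),
    hvan _ hh, zero_add, addCharOnBase_pow κ hψ hγN]

/-- **Summary (STEP 2 over the layer `ℚ_N`)**: `ψ` additive on `L_N`, vanishing on some `L_{m+N+2}`;
then for every `σ ∈ L_N` there are `h ∈ L_{N+1}`, `j` with `σ = h(γ^{p^N})^j` and
`ψ σ = j·ψ(γ^{p^N})`. [cite: Washington1997, §13.1] -/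
theorem exists_addCharOnBase_eq_mul {N : ℕ} {ψ : absoluteGaloisGroup K → ZMod p}
    (hψ : ∀ a ∈ κ.layerSubgroup N, ∀ b ∈ κ.layerSubgroup N, ψ (a * b) = ψ a + ψ b)
    {γ : absoluteGaloisGroup K} (hγ : κ.IsTopGenerator γ) (m : ℕ)
    (hvan : ∀ σ ∈ κ.layerSubgroup (m + N + 2), ψ σ = 0)
    {σ : absoluteGaloisGroup K} (hσ : σ ∈ κ.layerSubgroup N) :
    ∃ (h : absoluteGaloisGroup K) (j : ℕ), h ∈ κ.layerSubgroup (N + 1) ∧ σ = h * (γ ^ p ^ N) ^ j ∧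
      ψ σ = (j : ZMod p) * ψ (γ ^ p ^ N) := by
  obtain ⟨h, j, hj⟩ := κ.exists_layerSubgroup_succ_mul_pow hγ N ⟨σ, hσ⟩
  change σ = (h : absoluteGaloisGroup K) * (γ ^ p ^ N) ^ j at hj
  exact ⟨h, j, h.2, hj, addCharOnBase_eq_mul_of_layer_succ κ hψ hγ
    (addCharOnBase_eq_zero_layer_succ κ hψ hγ m hvan) h.2 hj⟩

end LayerCharTower

end Summit.BirchSwinnertonDyer.Rank1Residual.Additive
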